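import Literature.NumberTheory.NumberFields.SqrtTwoTowerThreeGaloisAction
import Literature.NumberTheory.IwasawaTheory.CyclotomicTwoLayerThreeNonNormUnit
import Literature.NumberTheory.IwasawaTheory.ClassGroupPRankLeOfRelationTwoAnyDepth
import HarnessLib

/-!
# `μ₂ = 0`, `λ₂ ≤ 5` FROM A RELATION ROW AT LAYER THREE: the t-free relation door of the cyclotomic `ℤ₂`-tower fed by COORDINATES —
# the class `c = [(q₀, s₃ − t)] ∈ Cl(K_3)`, the generator `σ : s₃ ↦ s₃³ − 3s₃` of `Gal(K_3/K)`, and ONE principal generator `y` of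
# `(1 + σ)(1 + σ⁴)·(q₀, s₃ − t) = (q₀, t₂² + s₁ − t₂ s₁s₂)` certified by its norm

`Proofs`-style file (theorems only: no definition, no named fact, no instance, no `sorry`) in topic `NumberTheory/IwasawaTheory` (namespace = path),
written by the prover seat `bsd-line-att-p4` g43 (cell `bsd-f1-sign2`, route `AlignedTransportAtTwo`; `--supports` stmt-BirchSwinnertonDyer-22298, closes nothing).
THE FIRST CONSUMER of att-p3 g49's relation door `classicalMuVanishes_two_of_relation_of_genusCert_layer_anyDepth` (`ClassGroupPRankLeOfRelationTwoAnyDepth`):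
every abstract input of that door at the layer `m = 3` — the generator `σ` of `Gal(K_3/K)`, the class `c`, the genus datum `N_{K_3/K_1}(c) = [𝔄]`,
`N_{K_1/K}(𝔄) = (q₀)`, and the relation `c·σc·σ⁴c·σ⁵c = 1` (`f = 1 + X + X⁴ + X⁵ = (X−1)⁵ + 2(3X⁴ − 5X³ + 5X² − 2X + 1)`, `d = 5 ≤ 2³ − 2`) — is produced
from COORDINATE DATA in `𝓞_K` on the basis `1, s₁, s₂, s₁s₂, s₃, s₁s₃, s₂s₃, s₁s₂s₃` of `K_3 = K·ℚ(ζ₃₂)⁺` (this seat's g41/g43 files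
`NumberFields/SqrtTwoTowerThreeOrderFourClassCertificate`, `…GaloisAction`; att-p3 g49's `Algebra.norm_tower3_eq`).

* ★★★ `classicalMuVanishes_two_of_relationCert_layer_three` — `K` odd degree, `2 ∤ d_K`, `κ` cyclotomic, two dyadic primes, `2 ∤ h_K`, `𝓞_K/𝔭₁ = 𝔽₂`, units
  `≡ ±1 (mod 𝔭₁³)`; DATA: `q₀ ∈ 𝓞_K` with `(q₀)` maximal and `q₀ ≡ ±3 (mod 𝔭₁³)`; `t, t₂ ∈ ℤ` with `t² − 2 ≡ t₂ (mod q₀)`; a residue map `ψ : 𝓞_K → ℤ/q`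
  (`q > 1` odd) with `ψ(q₀) = 0`, `P(t) = ((t²−2)²−2)²−2 = 0` in `ℤ/q`; Bézout data `α q₀⁸ + β P(t) = q₀`, `α₁ q₀ + 2t v₁ = 1`, `α₃ q₀ + ((4t₂²−4)² − 8) v₃ = 1`;
  an element `y = Σ yᵢ bᵢ` with `y = λ q₀ + μ·(t₂² + s₁ − t₂ s₁s₂)` in coordinates and `N_{K_3/K}(y) = ε q₀⁴` (`ε` a unit; the norm read through the three
  quadratic steps) ⟹ **`rank₂ Cl(K_l) ≤ 5 ∀ l`, `μ₂(κ) = 0`, `λ₂(κ) ≤ 5`**.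

WHY IT IS A PROOF.  `I₀ = (q₀, s₃ − t)` is proper (residue symbol) with `N_{K_3/K}(I₀) ⊇ (q₀⁸, P(t)) ∋ q₀`, so `N_{K_3/K}(I₀) = (q₀)` (maximality); the
conjugates are `σ^i I₀ = (q₀, σ^i s₃ − t)` with `σ⁴s₃ = −s₃`, `σ⁵ s₃ = −σ s₃`; Dedekind's two-generator calculus gives `I₀·σ⁴I₀ = (q₀, t₂ − s₂)`,
`σI₀·σ⁵I₀ = (q₀, t₂ − σs₂)`, and their product `A = (q₀, m)`, `m = t₂² + s₁ − t₂s₁s₂`; `y ∈ A` and `N(y)𝓞_K = (q₀)⁴ = N(A)` force `(y) = A`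
(cancellation of ideals in the Dedekind domain `𝓞_{K_3}`, `N(C) = (1) ⟹ C = (1)`).  Then att-p3's door.

CELL READING (crux C2, hard core `t = 3 ∧ e₁ = 1`): first customer `N = 1259` (att-p4 g42's relation-lattice datum: `q₀ = −7 + 2θ`, `t = 113`, `y` with
two-digit coordinates), giving `μ₂ = 0 ∧ λ₂ ≤ 5` there by the relation road.  HONEST SCOPE: classical; nothing about any summit is asserted here; BSD is not advanced.

References: [Washington1997] §13.1, §13.3 Prop. 13.22–13.23; [Lang1990] Ch. 13 §4 Lemma 4.1; [Fukuda1994] Thm. 1; [Gras2003] IV.4; [NeukirchANT1999] Ch. I §2,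
§3 (3.1)–(3.3) (unique factorisation, cancellation), §8, Ch. III (1.6)–(1.7) (relative norm of ideals, transitivity); [Cohen1993] §4.7, §6.5.
-/

set_option autoImplicit false

noncomputable section

open scoped NumberField nonZeroDivisors
open NumberField IsDedekindDomain Module Polynomial Finset

namespace Literature.NumberTheory.IwasawaTheory

open Literature.NumberTheory.EllipticCurves Literature.NumberTheory.NumberFields Literature.NumberTheory.NumberFields.AmbiguousClass

variable {K : Type} [Field K] [NumberField K]

set_option maxHeartbeats 3200000 in
set_option synthInstance.maxHeartbeats 400000 in
/-- ★★★ **`μ₂ = 0`, `λ₂ ≤ 5`, `rank₂ Cl(K_l) ≤ 5 ∀ l` FROM A LAYER-THREE RELATION ROW IN COORDINATES.**  `K` odd degree, `2 ∤ d_K`, `κ` cyclotomic,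
exactly two primes above `2`, `2 ∤ h_K`; `P ∋ 2` maximal with `𝓞_K/P = 𝔽₂`; all units `≡ ±1 (mod P³)`.  DATA: `q₀` with `(q₀)` maximal, `q₀ ≡ ±3 (mod P³)`;
`t, t₂ ∈ ℤ`, `w₂` with `t² − 2 = t₂ + q₀w₂`; `ψ : 𝓞_K → ℤ/q` (`1 < q`, `2tᵢ = 1`), `ψ q₀ = 0`, `P(t) = 0`; `α q₀⁸ + β P(t) = q₀`; `α₁q₀ + v₁·2t = 1`;
`α₃q₀ + v₃((4t₂²−4)²−8) = 1`; `y, λ, μ` (eight coordinates each) with `y = λq₀ + μ⋆(t₂², 1, 0, −t₂, 0, 0, 0, 0)`; the tower-norm templates `U, V` of `y` and a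
unit `ε` with `V₀² − 2V₁² = ε q₀⁴`.  THEN `rank₂ Cl(K_l) ≤ 5` for all `l`, `μ₂(κ) = 0`, `λ₂(κ) ≤ 5`.
[cite: Washington1997, §13.3 Prop. 13.22–13.23] [cite: Lang1990, Ch. 13 §4 Lemma 4.1] [cite: NeukirchANT1999, Ch. III (1.6)–(1.7); Ch. I §3 (3.3)]
[cite: Cohen1993, §4.7, §6.5] -/
theorem classicalMuVanishes_two_of_relationCert_layer_three (hK2 : ¬ 2 ∣ Module.finrank ℚ K) (hd : ¬ (2 : ℤ) ∣ NumberField.discr K)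
    (κ : ZpExtension K 2) (hκ : κ.IsCyclotomic)
    (h2card : {w : HeightOneSpectrum (𝓞 K) | ((2 : ℕ) : 𝓞 K) ∈ w.asIdeal}.ncard = 2)
    (hh : ¬ 2 ∣ classNumber K)
    (P : Ideal (𝓞 K)) [P.IsMaximal] (hres : ∀ r : 𝓞 K, r ∈ P ∨ r - 1 ∈ P) (h2P : (2 : 𝓞 K) ∈ P)
    (hunits : ∀ u : (𝓞 K)ˣ, (u : 𝓞 K) - 1 ∈ P ^ 3 ∨ (u : 𝓞 K) + 1 ∈ P ^ 3)
    (q₀ : 𝓞 K) (hq₀ : (Ideal.span {q₀}).IsMaximal) (hπ : q₀ - 3 ∈ P ^ 3 ∨ q₀ + 3 ∈ P ^ 3)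
    (t t₂ : ℤ) (w₂ : 𝓞 K) (ht₂ : (t : 𝓞 K) ^ 2 - 2 = t₂ + q₀ * w₂)
    {q : ℕ} (hq : 1 < q) (ψ : 𝓞 K →+* ZMod q) (hψ : ψ q₀ = 0) {ti : ZMod q} (hti : 2 * ti = 1)
    (hPt : (((t : ZMod q) ^ 2 - 2) ^ 2 - 2) ^ 2 - 2 = 0)
    (α β : 𝓞 K) (hBez : α * q₀ ^ 8 + β * ((((t : 𝓞 K) ^ 2 - 2) ^ 2 - 2) ^ 2 - 2) = q₀)
    (α₁ v₁ : 𝓞 K) (hC1 : α₁ * q₀ + v₁ * (2 * (t : 𝓞 K)) = 1)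
    (α₃ v₃ : 𝓞 K) (hC3 : α₃ * q₀ + v₃ * ((4 * (t₂ : 𝓞 K) ^ 2 - 4) ^ 2 - 8) = 1)
    (y₀ y₁ y₂ y₃ y₄ y₅ y₆ y₇ l₀ l₁ l₂ l₃ l₄ l₅ l₆ l₇ m₀ m₁ m₂ m₃ m₄ m₅ m₆ m₇ : 𝓞 K)
    (hy₀ : y₀ = l₀ * q₀ + ((t₂ : 𝓞 K) ^ 2 * m₀ + 2 * m₁ - 2 * (t₂ : 𝓞 K) * m₂ - 4 * (t₂ : 𝓞 K) * m₃))
    (hy₁ : y₁ = l₁ * q₀ + (m₀ + (t₂ : 𝓞 K) ^ 2 * m₁ - 2 * (t₂ : 𝓞 K) * m₂ - 2 * (t₂ : 𝓞 K) * m₃))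
    (hy₂ : y₂ = l₂ * q₀ + (-(2 * (t₂ : 𝓞 K)) * m₁ + (t₂ : 𝓞 K) ^ 2 * m₂ + 2 * m₃))
    (hy₃ : y₃ = l₃ * q₀ + (-(t₂ : 𝓞 K) * m₀ + m₂ + (t₂ : 𝓞 K) ^ 2 * m₃))
    (hy₄ : y₄ = l₄ * q₀ + ((t₂ : 𝓞 K) ^ 2 * m₄ + 2 * m₅ - 2 * (t₂ : 𝓞 K) * m₆ - 4 * (t₂ : 𝓞 K) * m₇))
    (hy₅ : y₅ = l₅ * q₀ + (m₄ + (t₂ : 𝓞 K) ^ 2 * m₅ - 2 * (t₂ : 𝓞 K) * m₆ - 2 * (t₂ : 𝓞 K) * m₇))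
    (hy₆ : y₆ = l₆ * q₀ + (-(2 * (t₂ : 𝓞 K)) * m₅ + (t₂ : 𝓞 K) ^ 2 * m₆ + 2 * m₇))
    (hy₇ : y₇ = l₇ * q₀ + (-(t₂ : 𝓞 K) * m₄ + m₆ + (t₂ : 𝓞 K) ^ 2 * m₇))
    (U₀ U₁ U₂ U₃ V₀ V₁ : 𝓞 K)
    (hU₀ : U₀ = -8 * y₇ ^ 2 - 8 * y₆ * y₇ - 4 * y₆ ^ 2 - 8 * y₅ * y₇ - 4 * y₅ * y₆ - 4 * y₅ ^ 2 - 4 * y₄ * y₇ - 4 * y₄ * y₆ - 2 * y₄ ^ 2 + 4 * y₃ ^ 2 + 4 * y₂ * y₃ +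
        2 * y₂ ^ 2 + 2 * y₁ ^ 2 + y₀ ^ 2)
    (hU₁ : U₁ = -4 * y₇ ^ 2 - 8 * y₆ * y₇ - 2 * y₆ ^ 2 - 4 * y₅ * y₇ - 4 * y₅ * y₆ - 4 * y₄ * y₇ - 2 * y₄ * y₆ - 4 * y₄ * y₅ + 2 * y₃ ^ 2 + 4 * y₂ * y₃ + y₂ ^ 2 +
        2 * y₀ * y₁)
    (hU₂ : U₂ = -4 * y₇ ^ 2 - 4 * y₆ * y₇ - 2 * y₆ ^ 2 - 8 * y₅ * y₇ - 2 * y₅ ^ 2 - 4 * y₄ * y₆ - y₄ ^ 2 + 4 * y₁ * y₃ + 2 * y₀ * y₂)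
    (hU₃ : U₃ = -2 * y₇ ^ 2 - 4 * y₆ * y₇ - y₆ ^ 2 - 4 * y₅ * y₆ - 4 * y₄ * y₇ - 2 * y₄ * y₅ + 2 * y₁ * y₂ + 2 * y₀ * y₃)
    (hV₀ : V₀ = -4 * U₃ ^ 2 - 4 * U₂ * U₃ - 2 * U₂ ^ 2 + 2 * U₁ ^ 2 + U₀ ^ 2) (hV₁ : V₁ = -2 * U₃ ^ 2 - 4 * U₂ * U₃ - U₂ ^ 2 + 2 * U₀ * U₁)
    (ε : (𝓞 K)ˣ) (hN : V₀ ^ 2 - 2 * V₁ ^ 2 = ε * q₀ ^ 4) :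
    (∀ l, classGroupPRank κ l ≤ 5) ∧ ClassicalMuVanishes κ ∧ classicalLambda κ ≤ 5 := by
  classical
  haveI : Fact (Nat.Prime 2) := ⟨Nat.prime_two⟩
  -- ### the layers `K₁ ⊂ K₂ ⊂ K₃`
  have h12 : κ.layer 1 ≤ κ.layer 2 := κ.layer_mono one_le_two
  have h23 : κ.layer 2 ≤ κ.layer 3 := κ.layer_mono (by norm_num)
  have h13 : κ.layer 1 ≤ κ.layer 3 := h12.trans h23
  letI alg12 : Algebra (κ.layer 1) (κ.layer 2) := (IntermediateField.inclusion h12).toRingHom.toAlgebra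
  letI alg23 : Algebra (κ.layer 2) (κ.layer 3) := (IntermediateField.inclusion h23).toRingHom.toAlgebra
  letI alg13 : Algebra (κ.layer 1) (κ.layer 3) := (IntermediateField.inclusion h13).toRingHom.toAlgebra
  haveI tow12 : IsScalarTower K (κ.layer 1) (κ.layer 2) :=
    IsScalarTower.of_algebraMap_eq fun x => ((IntermediateField.inclusion h12).commutes x).symm
  haveI tow23 : IsScalarTower K (κ.layer 2) (κ.layer 3) :=
    IsScalarTower.of_algebraMap_eq fun x => ((IntermediateField.inclusion h23).commutes x).symm
  haveI tow13 : IsScalarTower K (κ.layer 1) (κ.layer 3) :=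
    IsScalarTower.of_algebraMap_eq fun x => ((IntermediateField.inclusion h13).commutes x).symm
  haveI tow123 : IsScalarTower (κ.layer 1) (κ.layer 2) (κ.layer 3) :=
    IsScalarTower.of_algebraMap_eq fun x => (IntermediateField.inclusion_inclusion h12 h23 x).symm
  haveI : FiniteDimensional K (κ.layer 1) := κ.finiteDimensional_layer_holds 1
  haveI : FiniteDimensional K (κ.layer 2) := κ.finiteDimensional_layer_holds 2
  haveI : FiniteDimensional K (κ.layer 3) := κ.finiteDimensional_layer_holds 3
  haveI : NumberField (κ.layer 1) := NumberField.of_module_finite K _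
  haveI : NumberField (κ.layer 2) := NumberField.of_module_finite K _
  haveI : NumberField (κ.layer 3) := NumberField.of_module_finite K _
  haveI : IsGalois K (κ.layer 1) := κ.isGalois_layer_holds 1
  haveI : IsGalois K (κ.layer 2) := κ.isGalois_layer_holds 2
  haveI : IsGalois K (κ.layer 3) := κ.isGalois_layer_holds 3
  haveI : IsGalois (κ.layer 1) (κ.layer 2) := IsGalois.tower_top_of_isGalois K _ _
  haveI : IsGalois (κ.layer 2) (κ.layer 3) := IsGalois.tower_top_of_isGalois K _ _
  haveI : IsGalois (κ.layer 1) (κ.layer 3) := IsGalois.tower_top_of_isGalois K _ _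
  haveI : FiniteDimensional (κ.layer 1) (κ.layer 2) := Module.Finite.of_restrictScalars_finite K _ _
  haveI : FiniteDimensional (κ.layer 2) (κ.layer 3) := Module.Finite.of_restrictScalars_finite K _ _
  haveI : FiniteDimensional (κ.layer 1) (κ.layer 3) := Module.Finite.of_restrictScalars_finite K _ _
  have hdeg1 : Module.finrank K (κ.layer 1) = 2 := by rw [κ.finrank_layer_holds 1, pow_one]
  have hdeg2 : Module.finrank (κ.layer 1) (κ.layer 2) = 2 := by
    letI : Algebra (κ.layer 1) (κ.layer (1 + 1)) := alg12
    haveI : IsScalarTower K (κ.layer 1) (κ.layer (1 + 1)) := tow12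
    exact finrank_layer_one_layer_two κ
  have hdeg3 : Module.finrank (κ.layer 2) (κ.layer 3) = 2 := by
    letI : Algebra (κ.layer 2) (κ.layer (2 + 1)) := alg23
    haveI : IsScalarTower K (κ.layer 2) (κ.layer (2 + 1)) := tow23
    exact finrank_layer_two_layer_three κ
  have hdeg8 : Module.finrank K (κ.layer 3) = 8 := by rw [κ.finrank_layer_holds 3]; norm_num
  -- ### generators `s₁ ∈ K₁`, `s₂ ∈ K₂`, `s₃ ∈ K₃` and their integral copies `S₁, S₂, S₃ ∈ 𝓞 K₃`
  obtain ⟨s₁, s₂, s₃, hs₁, hs₂, hs₃, hs₁K, hs₂K, hs₃K⟩ := exists_generators_three_layers hK2 hd κ hκ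
  have hs₁int : IsIntegral ℤ s₁ := by
    refine ⟨Polynomial.X ^ 2 - Polynomial.C 2, Polynomial.monic_X_pow_sub_C _ two_ne_zero, ?_⟩
    simp [hs₁]
  have h2int₂ : IsIntegral ℤ (2 : κ.layer 2) := by
    have := isIntegral_algebraMap (R := ℤ) (A := κ.layer 2) (x := (2 : ℤ))
    rwa [map_ofNat] at this
  have hs₂int : IsIntegral ℤ s₂ := by
    refine IsIntegral.of_pow (n := 2) (by norm_num) ?_
    rw [hs₂, map_add, map_ofNat]
    exact h2int₂.add (map_isIntegral_int _ hs₁int)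
  have h2int : IsIntegral ℤ (2 : κ.layer 3) := by
    have := isIntegral_algebraMap (R := ℤ) (A := κ.layer 3) (x := (2 : ℤ))
    rwa [map_ofNat] at this
  have hs₃int : IsIntegral ℤ s₃ := by
    refine IsIntegral.of_pow (n := 2) (by norm_num) ?_
    rw [hs₃, map_add, map_ofNat]
    exact h2int.add (map_isIntegral_int _ hs₂int)
  obtain ⟨S₁, hS₁val⟩ : ∃ S : 𝓞 (κ.layer 3), algebraMap (𝓞 (κ.layer 3)) (κ.layer 3) S = algebraMap (κ.layer 1) (κ.layer 3) s₁ :=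
    ⟨⟨_, map_isIntegral_int (algebraMap (κ.layer 1) (κ.layer 3)) hs₁int⟩, rfl⟩
  obtain ⟨S₂, hS₂val⟩ : ∃ S : 𝓞 (κ.layer 3), algebraMap (𝓞 (κ.layer 3)) (κ.layer 3) S = algebraMap (κ.layer 2) (κ.layer 3) s₂ :=
    ⟨⟨_, map_isIntegral_int (algebraMap (κ.layer 2) (κ.layer 3)) hs₂int⟩, rfl⟩
  obtain ⟨S₃, hS₃val⟩ : ∃ S : 𝓞 (κ.layer 3), algebraMap (𝓞 (κ.layer 3)) (κ.layer 3) S = s₃ := ⟨⟨_, hs₃int⟩, rfl⟩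
  have h12L : ∀ x : κ.layer 1, algebraMap (κ.layer 2) (κ.layer 3) (algebraMap (κ.layer 1) (κ.layer 2) x) = algebraMap (κ.layer 1) (κ.layer 3) x := fun x =>
    (IsScalarTower.algebraMap_apply (κ.layer 1) (κ.layer 2) (κ.layer 3) x).symm
  have hS₁ : S₁ ^ 2 = 2 := by
    apply RingOfIntegers.coe_injective
    rw [map_pow, map_ofNat, hS₁val, ← map_pow, hs₁, map_ofNat]
  have hS₂ : S₂ ^ 2 = 2 + S₁ := by
    apply RingOfIntegers.coe_injective
    rw [map_pow, map_add, map_ofNat, hS₂val, hS₁val, ← map_pow, hs₂, h12L, map_add, map_ofNat]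
  have hS₃ : S₃ ^ 2 = 2 + S₂ := by
    apply RingOfIntegers.coe_injective
    rw [map_pow, map_add, map_ofNat, hS₃val, hS₂val, hs₃, map_add, map_ofNat]
  set f := algebraMap (𝓞 K) (𝓞 (κ.layer 3)) with hf
  have hcoe : ∀ z : 𝓞 K, algebraMap (𝓞 (κ.layer 3)) (κ.layer 3) (f z) = algebraMap K (κ.layer 3) (z : K) := fun z => by
    rw [hf]
    exact (IsScalarTower.algebraMap_apply (𝓞 K) (𝓞 (κ.layer 3)) (κ.layer 3) z).symm.trans
      (IsScalarTower.algebraMap_apply (𝓞 K) K (κ.layer 3) z)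
  have hia : ∀ (τ : (κ.layer 3) ≃ₐ[K] (κ.layer 3)) (x : 𝓞 (κ.layer 3)),
      algebraMap (𝓞 (κ.layer 3)) (κ.layer 3) ((intAut τ : 𝓞 (κ.layer 3) →+* 𝓞 (κ.layer 3)) x) = τ (algebraMap (𝓞 (κ.layer 3)) (κ.layer 3) x) :=
    fun τ x => rfl
  -- ### the generator `σ` of `Gal(K₃/K)` with `σ s₃ = s₃³ − 3 s₃`
  obtain ⟨σ, hσ⟩ := exists_algEquiv_apply_eq_tower3 (K := K) hdeg1 hdeg2 hdeg3 hs₁ hs₁K hs₂ hs₂K hs₃ hs₃K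
  have hgen : ∀ τ : (κ.layer 3) ≃ₐ[K] (κ.layer 3), τ ∈ Subgroup.zpowers σ :=
    forall_mem_zpowers_of_apply_eq_tower3 (K := K) hdeg1 hdeg2 hdeg3 hs₁ hs₁K hs₂ hs₂K hs₃ hσ
  obtain ⟨-, -, hσ1, -, -, hσ4, hσ5⟩ := tower3_galois_iterates (K := K) hs₁ hs₂ hs₃ hσ
  -- ### the ideal `I₀ = (q₀, S₃ − t)` and its conjugates
  have hq₀0 : q₀ ≠ 0 := fun h0 => by
    rw [h0, Ideal.span_singleton_zero] at hq₀
    exact Ring.ne_bot_of_isMaximal_of_not_isField hq₀ (RingOfIntegers.not_isField K) rfl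
  obtain ⟨b, hb⟩ : ∃ b : 𝓞 (κ.layer 3), b = f q₀ := ⟨_, rfl⟩
  have hbL : algebraMap (𝓞 (κ.layer 3)) (κ.layer 3) b = algebraMap K (κ.layer 3) (q₀ : K) := by rw [hb, hcoe]
  have hb0 : b ≠ 0 := fun h => hq₀0 (by
    have h' : algebraMap (𝓞 (κ.layer 3)) (κ.layer 3) b = 0 := by rw [h, map_zero]
    rw [hbL, map_eq_zero_iff _ (algebraMap K (κ.layer 3)).injective] at h'
    exact RingOfIntegers.coe_injective (by simpa using h'))
  have hI0 : Ideal.span {b, S₃ - t} ≠ ⊥ := fun h => hb0 (by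
    have : b ∈ Ideal.span {b, S₃ - (t : 𝓞 (κ.layer 3))} := Ideal.subset_span (by simp)
    rw [h, Ideal.mem_bot] at this
    exact this)
  -- `τ I₀ = (q₀, τ s₃ − t)`
  have hmapI : ∀ (τ : (κ.layer 3) ≃ₐ[K] (κ.layer 3)) (Z : 𝓞 (κ.layer 3)), algebraMap (𝓞 (κ.layer 3)) (κ.layer 3) Z = τ s₃ - t →
      (Ideal.span {b, S₃ - (t : 𝓞 (κ.layer 3))}).map (intAut τ : 𝓞 (κ.layer 3) →+* 𝓞 (κ.layer 3)) = Ideal.span {b, Z} := by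
    intro τ Z hZ
    rw [Ideal.map_span, Set.image_pair]
    have h1 : (intAut τ : 𝓞 (κ.layer 3) →+* 𝓞 (κ.layer 3)) b = b := by
      apply RingOfIntegers.coe_injective
      rw [hia, hbL]
      exact τ.commutes (q₀ : K)
    have h2 : (intAut τ : 𝓞 (κ.layer 3) →+* 𝓞 (κ.layer 3)) (S₃ - t) = Z := by
      apply RingOfIntegers.coe_injective
      rw [hia, hZ, map_sub, map_intCast, hS₃val, map_sub, map_intCast]
    rw [h1, h2]
  have hZ₀ : algebraMap (𝓞 (κ.layer 3)) (κ.layer 3) (S₃ - t) = (1 : (κ.layer 3) ≃ₐ[K] (κ.layer 3)) s₃ - t := by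
    rw [AlgEquiv.one_apply, map_sub, map_intCast, hS₃val]
  have hZ₁ : algebraMap (𝓞 (κ.layer 3)) (κ.layer 3) (S₂ * S₃ - S₃ - t) = σ s₃ - t := by
    rw [hσ1, map_sub, map_sub, map_mul, map_intCast, hS₃val, hS₂val]
  have hZ₄ : algebraMap (𝓞 (κ.layer 3)) (κ.layer 3) (-S₃ - t) = (σ ^ 4) s₃ - t := by
    rw [hσ4, map_sub, map_neg, map_intCast, hS₃val]
  have hZ₅ : algebraMap (𝓞 (κ.layer 3)) (κ.layer 3) (S₃ - S₂ * S₃ - t) = (σ ^ 5) s₃ - t := by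
    rw [hσ5, map_sub, map_sub, map_mul, map_intCast, hS₃val, hS₂val]
  -- ### the three two-generator products
  have hfC1 : f α₁ * b + (-f v₁) * (S₃ - t) + (-f v₁) * (-S₃ - t) = 1 := by
    have h := congrArg f hC1
    simp only [map_add, map_mul, map_one, map_intCast, map_ofNat] at h
    rw [hb]; linear_combination h
  have hfC1' : f α₁ * b + (-f v₁) * (S₂ * S₃ - S₃ - t) + (-f v₁) * (S₃ - S₂ * S₃ - t) = 1 := by
    have h := congrArg f hC1
    simp only [map_add, map_mul, map_one, map_intCast, map_ofNat] at h
    rw [hb]; linear_combination h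
  have ht₂f : (t : 𝓞 (κ.layer 3)) ^ 2 - 2 = t₂ + b * f w₂ := by
    have h := congrArg f ht₂
    simp only [map_add, map_sub, map_mul, map_pow, map_intCast, map_ofNat] at h
    rw [hb]; linear_combination h
  have hP04 : Ideal.span {b, S₃ - (t : 𝓞 (κ.layer 3))} * Ideal.span {b, -S₃ - (t : 𝓞 (κ.layer 3))} = Ideal.span {b, (t₂ : 𝓞 (κ.layer 3)) - S₂} := by
    rw [span_pair_mul_span_pair_eq_of_comax hfC1]
    have : (S₃ - (t : 𝓞 (κ.layer 3))) * (-S₃ - (t : 𝓞 (κ.layer 3))) = ((t₂ : 𝓞 (κ.layer 3)) - S₂) + b * f w₂ := by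
      linear_combination (-1 : 𝓞 (κ.layer 3)) * hS₃ + ht₂f
    rw [this, span_pair_add_mul_eq]
  have hP15 : Ideal.span {b, S₂ * S₃ - S₃ - (t : 𝓞 (κ.layer 3))} * Ideal.span {b, S₃ - S₂ * S₃ - (t : 𝓞 (κ.layer 3))} =
      Ideal.span {b, (t₂ : 𝓞 (κ.layer 3)) + S₂ - S₁ * S₂} := by
    rw [span_pair_mul_span_pair_eq_of_comax hfC1']
    have : (S₂ * S₃ - S₃ - (t : 𝓞 (κ.layer 3))) * (S₃ - S₂ * S₃ - (t : 𝓞 (κ.layer 3))) = ((t₂ : 𝓞 (κ.layer 3)) + S₂ - S₁ * S₂) + b * f w₂ := by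
      linear_combination ((-3) + (-1) * S₁ + 2 * S₂) * hS₃ + (2 + (-1) * S₃ ^ 2) * hS₂ + ht₂f
    rw [this, span_pair_add_mul_eq]
  have hfC3 : f α₃ * b + (f v₃ * ((2 * (t₂ : 𝓞 (κ.layer 3)) + S₁ * S₂) * (4 * (t₂ : 𝓞 (κ.layer 3)) ^ 2 - 4 + 2 * S₁))) * ((t₂ : 𝓞 (κ.layer 3)) - S₂)
      + (f v₃ * ((2 * (t₂ : 𝓞 (κ.layer 3)) + S₁ * S₂) * (4 * (t₂ : 𝓞 (κ.layer 3)) ^ 2 - 4 + 2 * S₁))) * ((t₂ : 𝓞 (κ.layer 3)) + S₂ - S₁ * S₂) = 1 := by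
    have h := congrArg f hC3
    simp only [map_add, map_sub, map_mul, map_pow, map_one, map_intCast, map_ofNat] at h
    rw [hb]
    linear_combination h + (f v₃ * (8 + (-2) * S₁ ^ 3 + (-4) * S₁ ^ 2 * (t₂ : 𝓞 (κ.layer 3)) ^ 2)) * hS₂
      + (f v₃ * ((-4) + (-4) * S₁ + (-2) * S₁ ^ 2 + 4 * S₂ ^ 2 + (-8) * (t₂ : 𝓞 (κ.layer 3)) ^ 2 + (-4) * S₁ * (t₂ : 𝓞 (κ.layer 3)) ^ 2)) * hS₁
  have hPA : Ideal.span {b, (t₂ : 𝓞 (κ.layer 3)) - S₂} * Ideal.span {b, (t₂ : 𝓞 (κ.layer 3)) + S₂ - S₁ * S₂} =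
      Ideal.span {b, (t₂ : 𝓞 (κ.layer 3)) ^ 2 + S₁ - (t₂ : 𝓞 (κ.layer 3)) * (S₁ * S₂)} := by
    rw [span_pair_mul_span_pair_eq_of_comax hfC3]
    have : ((t₂ : 𝓞 (κ.layer 3)) - S₂) * ((t₂ : 𝓞 (κ.layer 3)) + S₂ - S₁ * S₂) = (t₂ : 𝓞 (κ.layer 3)) ^ 2 + S₁ - (t₂ : 𝓞 (κ.layer 3)) * (S₁ * S₂) := by
      linear_combination ((-1) + S₁) * hS₂ + (1 : 𝓞 (κ.layer 3)) * hS₁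
    rw [this]
  -- ### `y ∈ A = (q₀, m)`
  have hymem : f y₀ + f y₁ * S₁ + (f y₂ + f y₃ * S₁) * S₂ + (f y₄ + f y₅ * S₁ + (f y₆ + f y₇ * S₁) * S₂) * S₃ ∈
      Ideal.span {b, (t₂ : 𝓞 (κ.layer 3)) ^ 2 + S₁ - (t₂ : 𝓞 (κ.layer 3)) * (S₁ * S₂)} := by
    rw [Ideal.mem_span_pair]
    refine ⟨f l₀ + f l₁ * S₁ + (f l₂ + f l₃ * S₁) * S₂ + (f l₄ + f l₅ * S₁ + (f l₆ + f l₇ * S₁) * S₂) * S₃,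
      f m₀ + f m₁ * S₁ + (f m₂ + f m₃ * S₁) * S₂ + (f m₄ + f m₅ * S₁ + (f m₆ + f m₇ * S₁) * S₂) * S₃, ?_⟩
    have e₀ := congrArg f hy₀
    have e₁ := congrArg f hy₁
    have e₂ := congrArg f hy₂
    have e₃ := congrArg f hy₃
    have e₄ := congrArg f hy₄
    have e₅ := congrArg f hy₅
    have e₆ := congrArg f hy₆
    have e₇ := congrArg f hy₇
    simp only [map_add, map_sub, map_mul, map_neg, map_pow, map_intCast, map_ofNat] at e₀ e₁ e₂ e₃ e₄ e₅ e₆ e₇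
    rw [← hb] at e₀ e₁ e₂ e₃ e₄ e₅ e₆ e₇
    linear_combination (-(1 : 𝓞 (κ.layer 3))) * e₀ + (-(S₁)) * e₁ + (-(S₂)) * e₂ + (-(S₁ * S₂)) * e₃ + (-(S₃)) * e₄ + (-(S₁ * S₃)) * e₅
      + (-(S₂ * S₃)) * e₆ + (-(S₁ * S₂ * S₃)) * e₇
      + ((-1) * f m₂ * S₁ * (t₂ : 𝓞 (κ.layer 3)) + (-1) * f m₃ * S₁ ^ 2 * (t₂ : 𝓞 (κ.layer 3)) + (-1) * f m₆ * S₁ * S₃ * (t₂ : 𝓞 (κ.layer 3))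
          + (-1) * f m₇ * S₁ ^ 2 * S₃ * (t₂ : 𝓞 (κ.layer 3))) * hS₂
      + (f m₁ + (-1) * f m₂ * (t₂ : 𝓞 (κ.layer 3)) + f m₃ * S₂ + (-2) * f m₃ * (t₂ : 𝓞 (κ.layer 3)) + f m₅ * S₃ + (-1) * f m₁ * S₂ * (t₂ : 𝓞 (κ.layer 3))
          + (-1) * f m₃ * S₁ * (t₂ : 𝓞 (κ.layer 3)) + (-1) * f m₆ * S₃ * (t₂ : 𝓞 (κ.layer 3)) + f m₇ * S₂ * S₃ + (-2) * f m₇ * S₃ * (t₂ : 𝓞 (κ.layer 3))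
          + (-1) * f m₅ * S₂ * S₃ * (t₂ : 𝓞 (κ.layer 3)) + (-1) * f m₇ * S₁ * S₃ * (t₂ : 𝓞 (κ.layer 3))) * hS₁
  -- ### norms: `N(I₀) = (q₀)`, `N(y) = ε q₀⁴`
  have hnormq : Algebra.intNorm (𝓞 K) (𝓞 (κ.layer 3)) b = q₀ ^ 8 := by
    apply RingOfIntegers.coe_injective
    rw [Algebra.algebraMap_intNorm (A := 𝓞 K) (K := K) (L := κ.layer 3) (B := 𝓞 (κ.layer 3)) b, hbL, Algebra.norm_algebraMap, hdeg8, map_pow]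
  have hnormz : Algebra.intNorm (𝓞 K) (𝓞 (κ.layer 3)) (S₃ - t) = (((t : 𝓞 K) ^ 2 - 2) ^ 2 - 2) ^ 2 - 2 := by
    apply RingOfIntegers.coe_injective
    rw [Algebra.algebraMap_intNorm (A := 𝓞 K) (K := K) (L := κ.layer 3) (B := 𝓞 (κ.layer 3)) (S₃ - t), map_sub, map_intCast, hS₃val]
    have hz : (s₃ - t : κ.layer 3) = algebraMap K (κ.layer 3) (-(t : K)) + algebraMap K (κ.layer 3) 0 * algebraMap (κ.layer 1) (κ.layer 3) s₁
        + (algebraMap K (κ.layer 3) 0 + algebraMap K (κ.layer 3) 0 * algebraMap (κ.layer 1) (κ.layer 3) s₁) * algebraMap (κ.layer 2) (κ.layer 3) s₂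
        + (algebraMap K (κ.layer 3) 1 + algebraMap K (κ.layer 3) 0 * algebraMap (κ.layer 1) (κ.layer 3) s₁
          + (algebraMap K (κ.layer 3) 0 + algebraMap K (κ.layer 3) 0 * algebraMap (κ.layer 1) (κ.layer 3) s₁) * algebraMap (κ.layer 2) (κ.layer 3) s₂) * s₃ := by
      simp only [map_neg, map_intCast, map_zero, map_one]; ring
    rw [hz, Algebra.norm_tower3_eq hdeg1 hdeg2 hdeg3 hs₁ hs₁K hs₂ hs₂K hs₃ hs₃K (-(t : K)) 0 0 0 1 0 0 0
      (U₀ := (t : K) ^ 2 - 2) (U₁ := 0) (U₂ := -1) (U₃ := 0) (V₀ := ((t : K) ^ 2 - 2) ^ 2 - 2) (V₁ := -1)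
      (by ring) (by ring) (by ring) (by ring) (by ring) (by ring)]
    simp only [map_sub, map_pow, map_intCast, map_ofNat]
    ring
  have hqmem : q₀ ∈ Ideal.relNorm (𝓞 K) (Ideal.span {b, S₃ - (t : 𝓞 (κ.layer 3))}) := by
    have h1 : Algebra.intNorm (𝓞 K) (𝓞 (κ.layer 3)) b ∈ Ideal.relNorm (𝓞 K) (Ideal.span {b, S₃ - (t : 𝓞 (κ.layer 3))}) :=
      Ideal.intNorm_mem_spanNorm (R := 𝓞 K) (Ideal.subset_span (by simp))
    have h2 : Algebra.intNorm (𝓞 K) (𝓞 (κ.layer 3)) (S₃ - t) ∈ Ideal.relNorm (𝓞 K) (Ideal.span {b, S₃ - (t : 𝓞 (κ.layer 3))}) :=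
      Ideal.intNorm_mem_spanNorm (R := 𝓞 K) (Ideal.subset_span (by simp))
    rw [hnormq] at h1
    rw [hnormz] at h2
    rw [← hBez]
    exact Ideal.add_mem _ (Ideal.mul_mem_left _ _ h1) (Ideal.mul_mem_left _ _ h2)
  have hI0top : Ideal.span {b, S₃ - (t : 𝓞 (κ.layer 3))} ≠ ⊤ := by
    rw [hb]
    exact span_pair_ne_top_of_residue_tower3 hdeg1 hdeg2 hdeg3 hs₁ hs₁K hs₂ hs₂K hs₃ hs₃K q₀ t hq ψ hψ hti hPt hS₃val
  have hNI₀ : Ideal.relNorm (𝓞 K) (Ideal.span {b, S₃ - (t : 𝓞 (κ.layer 3))}) = Ideal.span {q₀} := by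
    have hle : Ideal.span {q₀} ≤ Ideal.relNorm (𝓞 K) (Ideal.span {b, S₃ - (t : 𝓞 (κ.layer 3))}) := (Ideal.span_singleton_le_iff_mem _).mpr hqmem
    have hne : Ideal.relNorm (𝓞 K) (Ideal.span {b, S₃ - (t : 𝓞 (κ.layer 3))}) ≠ ⊤ := fun htop => hI0top (by
      have h := Ideal.relNorm_le_comap (𝓞 K) (Ideal.span {b, S₃ - (t : 𝓞 (κ.layer 3))})
      rw [htop, top_le_iff, Ideal.comap_eq_top_iff] at h
      exact h)
    exact (hq₀.eq_of_le hne hle).symm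
  have hnormy : Algebra.intNorm (𝓞 K) (𝓞 (κ.layer 3)) (f y₀ + f y₁ * S₁ + (f y₂ + f y₃ * S₁) * S₂ + (f y₄ + f y₅ * S₁ + (f y₆ + f y₇ * S₁) * S₂) * S₃) =
      ε * q₀ ^ 4 := by
    apply RingOfIntegers.coe_injective
    rw [Algebra.algebraMap_intNorm (A := 𝓞 K) (K := K) (L := κ.layer 3) (B := 𝓞 (κ.layer 3))]
    have hz : algebraMap (𝓞 (κ.layer 3)) (κ.layer 3) (f y₀ + f y₁ * S₁ + (f y₂ + f y₃ * S₁) * S₂ + (f y₄ + f y₅ * S₁ + (f y₆ + f y₇ * S₁) * S₂) * S₃) =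
        algebraMap K (κ.layer 3) (y₀ : K) + algebraMap K (κ.layer 3) (y₁ : K) * algebraMap (κ.layer 1) (κ.layer 3) s₁
        + (algebraMap K (κ.layer 3) (y₂ : K) + algebraMap K (κ.layer 3) (y₃ : K) * algebraMap (κ.layer 1) (κ.layer 3) s₁) * algebraMap (κ.layer 2) (κ.layer 3) s₂
        + (algebraMap K (κ.layer 3) (y₄ : K) + algebraMap K (κ.layer 3) (y₅ : K) * algebraMap (κ.layer 1) (κ.layer 3) s₁
          + (algebraMap K (κ.layer 3) (y₆ : K) + algebraMap K (κ.layer 3) (y₇ : K) * algebraMap (κ.layer 1) (κ.layer 3) s₁) * algebraMap (κ.layer 2) (κ.layer 3) s₂) * s₃ := by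
      simp only [map_add, map_mul, hcoe, hS₁val, hS₂val, hS₃val]
    have gU₀ := congrArg (algebraMap (𝓞 K) K) hU₀
    have gU₁ := congrArg (algebraMap (𝓞 K) K) hU₁
    have gU₂ := congrArg (algebraMap (𝓞 K) K) hU₂
    have gU₃ := congrArg (algebraMap (𝓞 K) K) hU₃
    have gV₀ := congrArg (algebraMap (𝓞 K) K) hV₀
    have gV₁ := congrArg (algebraMap (𝓞 K) K) hV₁
    have gN := congrArg (algebraMap (𝓞 K) K) hN
    simp only [map_add, map_sub, map_mul, map_pow, map_neg, map_ofNat] at gU₀ gU₁ gU₂ gU₃ gV₀ gV₁ gN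
    rw [hz, Algebra.norm_tower3_eq hdeg1 hdeg2 hdeg3 hs₁ hs₁K hs₂ hs₂K hs₃ hs₃K _ _ _ _ _ _ _ _ gU₀ gU₁ gU₂ gU₃ gV₀ gV₁]
    exact gN
  -- ### `(y) = A`: `y ∈ A` and `N((y)) = N(A) = (q₀)⁴`
  have hconj : ∀ τ : (κ.layer 3) ≃ₐ[K] (κ.layer 3),
      Ideal.relNorm (𝓞 K) ((Ideal.span {b, S₃ - (t : 𝓞 (κ.layer 3))}).map (intAut τ : 𝓞 (κ.layer 3) →+* 𝓞 (κ.layer 3))) = Ideal.span {q₀} := by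
    intro τ
    have hpt : ∀ x : 𝓞 (κ.layer 3), (intAut τ : 𝓞 (κ.layer 3) →+* 𝓞 (κ.layer 3)) x = galRestrict (𝓞 K) K (κ.layer 3) (𝓞 (κ.layer 3)) τ x := by
      intro x
      apply RingOfIntegers.coe_injective
      rw [hia, algebraMap_galRestrict_apply]
    have hm : (Ideal.span {b, S₃ - (t : 𝓞 (κ.layer 3))}).map (intAut τ : 𝓞 (κ.layer 3) →+* 𝓞 (κ.layer 3)) =
        (Ideal.span {b, S₃ - (t : 𝓞 (κ.layer 3))}).map (galRestrict (𝓞 K) K (κ.layer 3) (𝓞 (κ.layer 3)) τ) := by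
      unfold Ideal.map
      congr 1
      ext z
      simp only [Set.mem_image, SetLike.mem_coe, hpt]
    rw [hm, Ideal.relNorm_map_algEquiv, hNI₀]
  have hrelNormA : Ideal.relNorm (𝓞 K) (Ideal.span {b, (t₂ : 𝓞 (κ.layer 3)) ^ 2 + S₁ - (t₂ : 𝓞 (κ.layer 3)) * (S₁ * S₂)}) = Ideal.span {q₀} ^ 4 := by
    rw [← hPA, ← hP04, ← hP15, map_mul, map_mul, map_mul, ← hmapI 1 _ hZ₀, ← hmapI σ _ hZ₁, ← hmapI (σ ^ 4) _ hZ₄, ← hmapI (σ ^ 5) _ hZ₅,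
      hconj, hconj, hconj, hconj]
    ring
  have hyA : Ideal.span {f y₀ + f y₁ * S₁ + (f y₂ + f y₃ * S₁) * S₂ + (f y₄ + f y₅ * S₁ + (f y₆ + f y₇ * S₁) * S₂) * S₃} =
      Ideal.span {b, (t₂ : 𝓞 (κ.layer 3)) ^ 2 + S₁ - (t₂ : 𝓞 (κ.layer 3)) * (S₁ * S₂)} := by
    have hle := (Ideal.span_singleton_le_iff_mem _).mpr hymem
    obtain ⟨C, hC⟩ := Ideal.dvd_iff_le.mpr hle
    have hNy : Ideal.relNorm (𝓞 K) (Ideal.span {f y₀ + f y₁ * S₁ + (f y₂ + f y₃ * S₁) * S₂ + (f y₄ + f y₅ * S₁ + (f y₆ + f y₇ * S₁) * S₂) * S₃}) =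
        Ideal.span {q₀} ^ 4 := by
      rw [Ideal.relNorm_singleton, hnormy, Ideal.span_singleton_pow]
      exact Ideal.span_singleton_eq_span_singleton.mpr ⟨ε⁻¹, by simp [mul_comm]⟩
    have hne : Ideal.span {q₀} ^ 4 ≠ 0 := pow_ne_zero _ (by rw [Ne, Ideal.zero_eq_bot, Ideal.span_singleton_eq_bot]; exact hq₀0)
    have hNC : Ideal.relNorm (𝓞 K) C = ⊤ := by
      have h := congrArg (Ideal.relNorm (𝓞 K)) hC
      rw [map_mul, hNy, hrelNormA] at h
      have h' : Ideal.span {q₀} ^ 4 * Ideal.relNorm (𝓞 K) C = Ideal.span {q₀} ^ 4 * ⊤ := by rw [Ideal.mul_top]; exact h.symm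
      exact mul_left_cancel₀ hne h'
    have hCtop : C = ⊤ := by
      by_contra hC'
      obtain ⟨M, hM, hCM⟩ := Ideal.exists_le_maximal C hC'
      have h := Ideal.relNorm_mono (𝓞 K) hCM
      rw [hNC, top_le_iff] at h
      haveI := hM
      haveI : (M.under (𝓞 K)).IsMaximal := Ideal.IsMaximal.under (𝓞 K) M
      rw [Ideal.relNorm_eq_pow_of_isMaximal M (M.under (𝓞 K)), Ideal.pow_eq_top_iff] at h
      rcases h with h | h
      · exact (Ideal.IsMaximal.ne_top inferInstance) h
      · exact (Ideal.inertiaDeg_pos M (R := 𝓞 K)).ne' h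
    rw [hC, hCtop, Ideal.mul_top]
  -- ### the relation `∏ σ^i(I₀)^{f i} = (y)` and the door
  have hprod : ∏ i ∈ range 6, ((Ideal.span {b, S₃ - (t : 𝓞 (κ.layer 3))}).map (intAut (σ ^ i) : 𝓞 (κ.layer 3) →+* 𝓞 (κ.layer 3))) ^
        (fun i : ℕ => if i = 2 ∨ i = 3 then 0 else 1) i =
      Ideal.span {f y₀ + f y₁ * S₁ + (f y₂ + f y₃ * S₁) * S₂ + (f y₄ + f y₅ * S₁ + (f y₆ + f y₇ * S₁) * S₂) * S₃} := by
    simp only [Finset.prod_range_succ, Finset.prod_range_zero, one_mul]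
    norm_num
    rw [hmapI 1 _ hZ₀, hmapI σ _ hZ₁, hmapI (σ ^ 4) _ hZ₄, hmapI (σ ^ 5) _ hZ₅, hyA, ← hPA, ← hP04, ← hP15]
    ring
  have hrel := prod_pow_mulEquiv_intAut_mk0_eq_one (F := K) σ hI0 hprod
  have hA0 : Ideal.relNorm (𝓞 (κ.layer 1)) (Ideal.span {b, S₃ - (t : 𝓞 (κ.layer 3))}) ≠ ⊥ :=
    (Ideal.relNorm_eq_bot_iff (R := 𝓞 (κ.layer 1))).not.mpr hI0
  have hA : Ideal.relNorm (𝓞 K) (Ideal.relNorm (𝓞 (κ.layer 1)) (Ideal.span {b, S₃ - (t : 𝓞 (κ.layer 3))})) ^ 1 = Ideal.span {q₀} := by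
    rw [pow_one, Ideal.relNorm_relNorm, hNI₀]
  have hcA : classGroupNorm (κ.layer 1) (κ.layer 3) (ClassGroup.mk0 ⟨Ideal.span {b, S₃ - (t : 𝓞 (κ.layer 3))}, mem_nonZeroDivisors_of_ne_zero hI0⟩) =
      ClassGroup.mk0 ⟨Ideal.relNorm (𝓞 (κ.layer 1)) (Ideal.span {b, S₃ - (t : 𝓞 (κ.layer 3))}), mem_nonZeroDivisors_of_ne_zero hA0⟩ :=
    classGroupNorm_mk0 (κ.layer 1) ⟨_, mem_nonZeroDivisors_of_ne_zero hI0⟩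
  have hF : (∑ i ∈ range 6, C (((fun i : ℕ => if i = 2 ∨ i = 3 then 0 else 1) i : ℕ) : ℤ) * X ^ i : ℤ[X]) =
      (X - 1) ^ 5 * 1 + C (2 : ℤ) * (3 * X ^ 4 - 5 * X ^ 3 + 5 * X ^ 2 - 2 * X + 1) := by
    simp only [Finset.sum_range_succ, Finset.sum_range_zero, zero_add]
    norm_num
    ring
  have hu : ¬ (2 : ℤ) ∣ (1 : ℤ[X]).eval 1 := by norm_num
  exact classicalMuVanishes_two_of_relation_of_genusCert_layer_anyDepth hK2 hd κ hκ h2card hh (m := 3) (by norm_num) P hres h2P hunits hπ hA0 hA σ hgen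
    hcA (N := 6) (d := 5) (by norm_num) hu hF hrel

end Literature.NumberTheory.IwasawaTheory

end
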